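import Summits.BirchSwinnertonDyer.BirchSwinnertonDyer.Theses.EdixhovenFibreFiveSeven
import Summits.BirchSwinnertonDyer.BirchSwinnertonDyer.Theorems.EdixhovenFibreFiveSevenTwistDegreeStepFiveSeven
import HarnessLib

/-!
# Route `EdixhovenFibreFiveSeven`, support item `TwistDegreeStepFiveSevenOfKP` (stmt-BirchSwinnertonDyer-23812):
# TDS57 GRANTED the PUB bundles and the Kosters–Pannekoek residue crux KP57 — closed by name

Cell `pub/bsd-wall` (D-0145 line `route-BirchSwinnertonDyer-EdixhovenFibreFiveSeven`, rev 2), seat `bsd-line-edix-p1`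
(prover, g2). The rev-2 re-glue (planner bsd-idea-3 g2) files
`TwistDegreeStepFiveSevenOfKP := KatoNeronAndCremonaFacts → PublishedManinFacts → KPResidueManinUnitFiveSeven →
TwistDegreeStepFiveSeven`, consumed by `closes` as `hT := hT' hPK hF hK`: TDS57 (stmt-BirchSwinnertonDyer-22227)
GRANTED the PUB bundle (F″ = `kato_neron_isIntegral_twistedSymbolSum_of_additive_five_le` ∧ Cremona's `|c₀| = 1`
for `N ≤ 5·10⁵`), the Manin-facts bundle (7th conjunct = Česnavičius–Neururer–Saha `v_p(c) ≤ v_p(deg φ)`) and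
the new crux KP57 `KPResidueManinUnitFiveSeven` (stmt-BirchSwinnertonDyer-23810: Manin's `p`-part, some
conductor-level datum, for unstarred additive `V` at `p ∈ {5, 7}` with `E[p]` irreducible whose class carries a
`ℚ_p`-rational point of order `p`, all conductor-level degrees `≡ 0 (mod p)`, `N > 5·10⁵`). It is exactly the item
form of seat edix-p2's landed reduction `TwistDegreeStepFiveSeven.twistDegreeStepFiveSeven_of_kato_cns_cremona_of_kpResidue`
(p582423: off the Kosters–Pannekoek sub-residue the tame-twist lever; the ČNS degree slice; Cremona's range; the
residue is KP57 verbatim). HONEST STATUS: this closes the SUPPORT item by name; TDS57 itself stays conditional on F″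
and on KP57 (which seats edix-p2 and edix-p3 are reducing to F″ + L-TWIST via the unit-twist repair). BSD is not proved by
any of this.
-/

set_option autoImplicit false
-- the Theorems namespace of this sub repeats the summit name by design (D-0017 nested layout)
set_option linter.dupNamespace false

namespace Summit.BirchSwinnertonDyer.BirchSwinnertonDyer.Theorems

/-- **`TwistDegreeStepFiveSevenOfKP` (stmt-BirchSwinnertonDyer-23812) holds**: GRANTED `KatoNeronAndCremonaFacts`
(F″ ∧ Cremona), `PublishedManinFacts` (its 7th conjunct, Česnavičius–Neururer–Saha) and the crux
`KPResidueManinUnitFiveSeven`, TDS57 `TwistDegreeStepFiveSeven` — by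
`TwistDegreeStepFiveSeven.twistDegreeStepFiveSeven_of_kato_cns_cremona_of_kpResidue` (p582423).
[cite: Kato2004Asterisque, (8.1.3) (p. 180), Thm. 9.7 (p. 189)] [cite: CesnaviciusNeururerSaha2023, Thm. 1.2]
[cite: AgasheRibetStein2006, Thm. 2.6] [cite: KostersPannekoek2017, Thm. 1 and Cor. 2] -/
theorem twistDegreeStepFiveSevenOfKP_proof :
    Summit.BirchSwinnertonDyer.BirchSwinnertonDyer.Theses.EdixhovenFibreFiveSeven.TwistDegreeStepFiveSevenOfKP := by
  unfold Summit.BirchSwinnertonDyer.BirchSwinnertonDyer.Theses.EdixhovenFibreFiveSeven.TwistDegreeStepFiveSevenOfKP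
  intro h hF hKP
  exact TwistDegreeStepFiveSeven.twistDegreeStepFiveSeven_of_kato_cns_cremona_of_kpResidue h.1 hF.2.2.2.2.2.2 h.2 hKP

end Summit.BirchSwinnertonDyer.BirchSwinnertonDyer.Theorems
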